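import Summits.RiemannHypothesis.RiemannHypothesis.Theorems.WeilFormatCDeflatedFarCouplingGram
import HarnessLib

/-!
# Format C, design C∞ ("DoorB"): the structured tail for the SHIFTED coupling `g − VΛ`

Route context: Fourier–Galerkin / Schur-complement certificates of Weil positivity on a window ("format C";
cell memo `run/shared/lean/pub/rh-explicit/rh-explicit-weil-10/KERNEL-LEVER.md` §19–§20, sizing note
`run/shared/lean/pub/rh-explicit/rh-explicit-weil-2/gen9/CINF-DOOR-SIZING.md` §6–§7; supporting stmt-RiemannHypothesis-0098;
seat rh-explicit-weil-10).

The DoorB certificates (`sum_range_mul_mul_nonneg_of_certificate_cinfB`, `weilPositivityOn_of_formatC_cinfB(A)`) ask for ONE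
majorant of the shifted limit coupling `Σ_{m∈[B,N)} (Σ_i M(i,m)x_i + Σ_j c∞(m,j)β_j − Σ_j V(m,j)Λ_j(x,β))²/d̂_m`, every `N`.
With the free map given by two data matrices (`Λ_j(x,β) = Σ_i Λ₁(j,i)x_i + Σ_{j'} Λ₂(j,j')β_{j'}`, `WeilFormatCDeflatedFarFreeMap`)
and the profile table expanded EXACTLY over the families (`V(m,j) = ε(m)Σ_f R(f,j)φ_f(m)` — window polynomials: closed
Fourier coefficients, `fourierCoeff_ofReal_pow_eq_sum`), the shifted rows and images are again family expansions with the
SAME remainders and the shifted coefficient matrices `P − RᵀΛ₁`, `Q − RᵀΛ₂`; so `coupling_majorant_gram` applies verbatim: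

* `couplingGram_tail_le_fin`, `coupling_majorant_gram_fin` — `coupling_majorant_gram` with `Fin`-indexed rows;
* `shifted_image_eq` — `g_m − (VΛ)_m = Σ_i M̃(i,m)x_i + Σ_j c̃(m,j)β_j` with `M̃ = M − VΛ₁`, `c̃ = c − VΛ₂`;
* `abs_shifted_row_sub_families_le` / `abs_shifted_image_sub_families_le` — the shifted expansions keep the remainders;
* **`coupling_majorant_gram_shifted`** — the `hUq` of the DoorB certificates:
  `Σ_{m∈[B,N)} (g_m − (VΛ)_m)²/d̂_m ≤ Ufin(x,β) + ((1+θ)Γ((P − RᵀΛ₁)x + (Q − RᵀΛ₂)β) + (1+θ⁻¹)W(Σρ)(Σρ_i z_i²))/d₀`.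

Pure finite-dimensional real algebra; standard axioms; nothing Weil-specific; no RH claim.
-/

set_option autoImplicit false
-- `Summit.RiemannHypothesis.RiemannHypothesis.…` is the layout-mandated namespace (summit = problem name).
set_option linter.dupNamespace false

namespace Summit.RiemannHypothesis.RiemannHypothesis.Theorems.WeilFormatC

open Finset

/-- **The shifted image of one mode in coordinates**: with `Λ_j = Σ_i Λ₁(j,i)x_i + Σ_{j'} Λ₂(j,j')β_{j'}`,
`(Σ_i M_i x_i + Σ_j c_j β_j) − Σ_j V_j Λ_j = Σ_i (M_i − Σ_j V_jΛ₁(j,i))x_i + Σ_{j'} (c_{j'} − Σ_j V_jΛ₂(j,j'))β_{j'}`. -/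
theorem shifted_image_eq {B r : ℕ} (Mi : Fin B → ℝ) (cj Vj : Fin r → ℝ) (Λ₁ : Fin r → Fin B → ℝ)
    (Λ₂ : Fin r → Fin r → ℝ) (x : Fin B → ℝ) (β : Fin r → ℝ) :
    (∑ i, Mi i * x i + ∑ j, cj j * β j) - ∑ j, Vj j * (∑ i, Λ₁ j i * x i + ∑ j', Λ₂ j j' * β j')
      = ∑ i, (Mi i - ∑ j, Vj j * Λ₁ j i) * x i + ∑ j', (cj j' - ∑ j, Vj j * Λ₂ j j') * β j' := by
  have h1 : ∑ j, Vj j * (∑ i, Λ₁ j i * x i + ∑ j', Λ₂ j j' * β j')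
      = ∑ i, (∑ j, Vj j * Λ₁ j i) * x i + ∑ j', (∑ j, Vj j * Λ₂ j j') * β j' := by
    have e : ∀ j, Vj j * (∑ i, Λ₁ j i * x i + ∑ j', Λ₂ j j' * β j')
        = ∑ i, Vj j * Λ₁ j i * x i + ∑ j', Vj j * Λ₂ j j' * β j' := fun j ↦ by
      rw [mul_add, Finset.mul_sum, Finset.mul_sum]
      congr 1
      · exact Finset.sum_congr rfl fun i _ ↦ by ring
      · exact Finset.sum_congr rfl fun j' _ ↦ by ring
    rw [Finset.sum_congr rfl fun j _ ↦ e j, Finset.sum_add_distrib, Finset.sum_comm,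
      Finset.sum_comm (f := fun j j' ↦ Vj j * Λ₂ j j' * β j')]
    congr 1
    · exact Finset.sum_congr rfl fun i _ ↦ by rw [Finset.sum_mul]
    · exact Finset.sum_congr rfl fun j' _ ↦ by rw [Finset.sum_mul]
  rw [h1]
  simp only [sub_mul, Finset.sum_sub_distrib]
  ring

/-- **Shifted rows keep the remainder**: if `|M_i − εΣ_f P(f,i)φ_f| ≤ ρ_i w` and `V_j = εΣ_f R(f,j)φ_f` (exact), then
`|(M_i − Σ_j V_jΛ₁(j,i)) − εΣ_f (P(f,i) − Σ_j R(f,j)Λ₁(j,i))φ_f| ≤ ρ_i w`. -/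
theorem abs_shifted_row_sub_families_le {B r F : ℕ} {Mi : Fin B → ℝ} {Vj : Fin r → ℝ} {ε : ℝ} {φ : Fin F → ℝ}
    {P : Fin F → Fin B → ℝ} {R : Fin F → Fin r → ℝ} {w : ℝ} {ρ : Fin B → ℝ}
    (hM : ∀ i, |Mi i - ε * ∑ f, P f i * φ f| ≤ ρ i * w) (hV : ∀ j, Vj j = ε * ∑ f, R f j * φ f)
    (Λ₁ : Fin r → Fin B → ℝ) (i : Fin B) :
    |(Mi i - ∑ j, Vj j * Λ₁ j i) - ε * ∑ f, (P f i - ∑ j, R f j * Λ₁ j i) * φ f| ≤ ρ i * w := by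
  have e : (Mi i - ∑ j, Vj j * Λ₁ j i) - ε * ∑ f, (P f i - ∑ j, R f j * Λ₁ j i) * φ f
      = Mi i - ε * ∑ f, P f i * φ f := by
    have h1 : ∑ j, Vj j * Λ₁ j i = ε * ∑ f, (∑ j, R f j * Λ₁ j i) * φ f := by
      calc ∑ j, Vj j * Λ₁ j i = ∑ j, ∑ f, ε * R f j * φ f * Λ₁ j i := by
            refine Finset.sum_congr rfl fun j _ ↦ ?_
            rw [hV j, Finset.mul_sum, Finset.sum_mul]
            exact Finset.sum_congr rfl fun f _ ↦ by ring
        _ = ∑ f, ∑ j, ε * R f j * φ f * Λ₁ j i := Finset.sum_comm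
        _ = ε * ∑ f, (∑ j, R f j * Λ₁ j i) * φ f := by
            rw [Finset.mul_sum]
            refine Finset.sum_congr rfl fun f _ ↦ ?_
            rw [Finset.sum_mul, Finset.mul_sum]
            exact Finset.sum_congr rfl fun j _ ↦ by ring
    rw [h1]
    simp only [sub_mul, Finset.sum_sub_distrib, mul_sub]
    ring
  rw [e]
  exact hM i

/-- **Shifted images keep the remainder**: if `|c_{j'} − εΣ_f Q(f,j')φ_f| ≤ ρ_{j'} w` and `V_j = εΣ_f R(f,j)φ_f`, then
`|(c_{j'} − Σ_j V_jΛ₂(j,j')) − εΣ_f (Q(f,j') − Σ_j R(f,j)Λ₂(j,j'))φ_f| ≤ ρ_{j'} w`. -/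
theorem abs_shifted_image_sub_families_le {r F : ℕ} {cj Vj : Fin r → ℝ} {ε : ℝ} {φ : Fin F → ℝ}
    {Q R : Fin F → Fin r → ℝ} {w : ℝ} {ρ : Fin r → ℝ}
    (hc : ∀ j', |cj j' - ε * ∑ f, Q f j' * φ f| ≤ ρ j' * w) (hV : ∀ j, Vj j = ε * ∑ f, R f j * φ f)
    (Λ₂ : Fin r → Fin r → ℝ) (j' : Fin r) :
    |(cj j' - ∑ j, Vj j * Λ₂ j j') - ε * ∑ f, (Q f j' - ∑ j, R f j * Λ₂ j j') * φ f| ≤ ρ j' * w :=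
  abs_shifted_row_sub_families_le (Mi := cj) hc hV Λ₂ j'

/-! ## `coupling_majorant_gram` with `Fin`-indexed rows -/

/-- **The structured tail, `Fin`-indexed rows**: on `[B₃, N)`, with family expansions of rows and images (remainders `ρ·w(m)`,
`Σ w² ≤ W`), a floor `d₀ ≤ d̂`, and any `N`-uniform Gram majorant `Γ` of the families,
`Σ_{m∈[B₃,N)} (Σ_i M(i,m)x_i + Σ_j c(m,j)β_j)²/d̂_m
  ≤ ((1+θ)·Γ(u) + (1+θ⁻¹)·W·(Σρx + Σρβ)·(Σ_i ρx_i x_i² + Σ_j ρβ_j β_j²))/d₀`, `u_f = Σ_i P(f,i)x_i + Σ_j Q(f,j)β_j`. -/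
theorem couplingGram_tail_le_fin {B B₃ r F : ℕ} (M : Fin B → ℕ → ℝ) (c : ℕ → Fin r → ℝ) (dhat : ℕ → ℝ)
    {d₀ : ℝ} (hd₀ : 0 < d₀) (hd₃ : ∀ m, B₃ ≤ m → d₀ ≤ dhat m)
    (ε : ℕ → ℝ) (hε : ∀ m, ε m ^ 2 = 1)
    (φ : Fin F → ℕ → ℝ) (P : Fin F → Fin B → ℝ) (Q : Fin F → Fin r → ℝ)
    (w : ℕ → ℝ) (ρx : Fin B → ℝ) (ρβ : Fin r → ℝ) (hρx : ∀ i, 0 ≤ ρx i) (hρβ : ∀ j, 0 ≤ ρβ j)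
    (hM : ∀ m, B₃ ≤ m → ∀ i : Fin B, |M i m - ε m * ∑ f, P f i * φ f m| ≤ ρx i * w m)
    (hc : ∀ m, B₃ ≤ m → ∀ j : Fin r, |c m j - ε m * ∑ f, Q f j * φ f m| ≤ ρβ j * w m)
    {W : ℝ} (hW : ∀ N, ∑ m ∈ Ico B₃ N, w m ^ 2 ≤ W)
    (Γ : (Fin F → ℝ) → ℝ) (hΓ : ∀ (N : ℕ) (u : Fin F → ℝ), ∑ m ∈ Ico B₃ N, (∑ f, u f * φ f m) ^ 2 ≤ Γ u)
    {θ : ℝ} (hθ : 0 < θ) (N : ℕ) (x : Fin B → ℝ) (β : Fin r → ℝ) :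
    ∑ m ∈ Ico B₃ N, (∑ i : Fin B, M i m * x i + ∑ j, c m j * β j) ^ 2 / dhat m
      ≤ ((1 + θ) * Γ (fun f ↦ ∑ i, P f i * x i + ∑ j, Q f j * β j)
          + (1 + 1 / θ) * (W * ((∑ i, ρx i + ∑ j, ρβ j) * (∑ i, ρx i * x i ^ 2 + ∑ j, ρβ j * β j ^ 2)))) / d₀ := by
  set u : Fin F → ℝ := fun f ↦ ∑ i, P f i * x i + ∑ j, Q f j * β j with hu
  set A := ∑ i, ρx i * |x i| + ∑ j, ρβ j * |β j| with hA
  have hθ' : 0 ≤ 1 + 1 / θ := by positivity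
  -- termwise bound on the tail range
  have hterm : ∀ m ∈ Ico B₃ N, (∑ i : Fin B, M i m * x i + ∑ j, c m j * β j) ^ 2 / dhat m
      ≤ ((1 + θ) * (∑ f, u f * φ f m) ^ 2 + (1 + 1 / θ) * (A ^ 2 * w m ^ 2)) / d₀ := by
    intro m hm
    have hm' : B₃ ≤ m := (Finset.mem_Ico.1 hm).1
    have hdm : d₀ ≤ dhat m := hd₃ m hm'
    have hsq := sq_couplingGram_image_le (hε m) (hM m hm') (hc m hm') hθ x β
    have e : (∑ f, (∑ i, P f i * x i + ∑ j, Q f j * β j) * φ f m) = ∑ f, u f * φ f m := rfl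
    rw [e, ← hA, mul_pow] at hsq
    calc (∑ i : Fin B, M i m * x i + ∑ j, c m j * β j) ^ 2 / dhat m
        ≤ (∑ i : Fin B, M i m * x i + ∑ j, c m j * β j) ^ 2 / d₀ :=
          div_le_div_of_nonneg_left (sq_nonneg _) hd₀ hdm
      _ ≤ _ := div_le_div_of_nonneg_right hsq hd₀.le
  refine (Finset.sum_le_sum hterm).trans ?_
  rw [← Finset.sum_div]
  refine div_le_div_of_nonneg_right ?_ hd₀.le
  rw [Finset.sum_add_distrib, ← Finset.mul_sum, ← Finset.mul_sum, ← Finset.mul_sum]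
  refine add_le_add (mul_le_mul_of_nonneg_left (hΓ N u) (by linarith)) (mul_le_mul_of_nonneg_left ?_ hθ')
  -- `A² Σ w² ≤ W (Σρ)(Σρ z²)`
  have hA2 : A ^ 2 ≤ (∑ i, ρx i + ∑ j, ρβ j) * (∑ i, ρx i * x i ^ 2 + ∑ j, ρβ j * β j ^ 2) :=
    couplingGram_weighted_cs ρx ρβ hρx hρβ x β
  have hW0 : 0 ≤ W := le_trans (Finset.sum_nonneg fun m _ ↦ sq_nonneg (w m)) (hW N)
  calc A ^ 2 * ∑ m ∈ Ico B₃ N, w m ^ 2 ≤ A ^ 2 * W :=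
        mul_le_mul_of_nonneg_left (hW N) (sq_nonneg _)
    _ = W * A ^ 2 := mul_comm _ _
    _ ≤ W * ((∑ i, ρx i + ∑ j, ρβ j) * (∑ i, ρx i * x i ^ 2 + ∑ j, ρβ j * β j ^ 2)) :=
        mul_le_mul_of_nonneg_left hA2 hW0



/-- **The coupling majorant with a structured tail, `Fin`-indexed rows** (`B ≤ B₃`; `coupling_majorant_gram` verbatim with
`M : Fin B → ℕ → ℝ`, so that shifted rows need no extension to `ℕ`): an exact majorant `Ufin` on `[B, B₃)`, family expansions
of the rows `M(i,m)` and of the images `c(m,j)` on `[B₃, ∞)` with common sign `ε(m)` (`ε(m)² = 1`), remainders `ρx_i·w(m)`,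
`ρβ_j·w(m)` (`ρ ≥ 0`, `Σ_{m∈[B₃,N)} w² ≤ W`), a floor `0 < d₀ ≤ d̂_m` on `[B₃, ∞)` (`d̂ > 0` on `[B, ∞)`), and ANY Gram
majorant `Γ` of the families (`Σ_{m∈[B₃,N)} (Σ_f u_f φ_f(m))² ≤ Γ(u)` for all `N`, `u`) give, for every `N`, `x`, `β`:
`Σ_{m∈[B,N)} (Σ_i M(i,m)x_i + Σ_j c(m,j)β_j)²/d̂_m
  ≤ Ufin(x,β) + ((1+θ)·Γ(Px + Qβ) + (1+θ⁻¹)·W·(Σρx + Σρβ)·(Σ_i ρx_i x_i² + Σ_j ρβ_j β_j²))/d₀`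
— the hypothesis `hUq` of `weilPositivityOn_of_formatC_cinf` with a direction-tracking tail. -/
theorem coupling_majorant_gram_fin {B B₃ r F : ℕ} (M : Fin B → ℕ → ℝ) (hBB : B ≤ B₃) (c : ℕ → Fin r → ℝ)
    (dhat : ℕ → ℝ) (hd : ∀ m, B ≤ m → 0 < dhat m) {d₀ : ℝ} (hd₀ : 0 < d₀) (hd₃ : ∀ m, B₃ ≤ m → d₀ ≤ dhat m)
    (Ufin : (Fin B → ℝ) → (Fin r → ℝ) → ℝ)
    (hfin : ∀ (x : Fin B → ℝ) (β : Fin r → ℝ),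
      ∑ m ∈ Ico B B₃, (∑ i : Fin B, M i m * x i + ∑ j, c m j * β j) ^ 2 / dhat m ≤ Ufin x β)
    (ε : ℕ → ℝ) (hε : ∀ m, ε m ^ 2 = 1)
    (φ : Fin F → ℕ → ℝ) (P : Fin F → Fin B → ℝ) (Q : Fin F → Fin r → ℝ)
    (w : ℕ → ℝ) (ρx : Fin B → ℝ) (ρβ : Fin r → ℝ) (hρx : ∀ i, 0 ≤ ρx i) (hρβ : ∀ j, 0 ≤ ρβ j)
    (hM : ∀ m, B₃ ≤ m → ∀ i : Fin B, |M i m - ε m * ∑ f, P f i * φ f m| ≤ ρx i * w m)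
    (hc : ∀ m, B₃ ≤ m → ∀ j : Fin r, |c m j - ε m * ∑ f, Q f j * φ f m| ≤ ρβ j * w m)
    {W : ℝ} (hW : ∀ N, ∑ m ∈ Ico B₃ N, w m ^ 2 ≤ W)
    (Γ : (Fin F → ℝ) → ℝ) (hΓ : ∀ (N : ℕ) (u : Fin F → ℝ), ∑ m ∈ Ico B₃ N, (∑ f, u f * φ f m) ^ 2 ≤ Γ u)
    {θ : ℝ} (hθ : 0 < θ) (N : ℕ) (x : Fin B → ℝ) (β : Fin r → ℝ) :
    ∑ m ∈ Ico B N, (∑ i : Fin B, M i m * x i + ∑ j, c m j * β j) ^ 2 / dhat m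
      ≤ Ufin x β + ((1 + θ) * Γ (fun f ↦ ∑ i, P f i * x i + ∑ j, Q f j * β j)
          + (1 + 1 / θ) * (W * ((∑ i, ρx i + ∑ j, ρβ j) * (∑ i, ρx i * x i ^ 2 + ∑ j, ρβ j * β j ^ 2)))) / d₀ := by
  have htail := couplingGram_tail_le_fin M c dhat hd₀ hd₃ ε hε φ P Q w ρx ρβ hρx hρβ hM hc hW Γ hΓ hθ N x β
  -- the tail term is nonnegative (Γ u ≥ 0 from the empty range, W ≥ 0 likewise)
  have hΓ0 : 0 ≤ Γ (fun f ↦ ∑ i, P f i * x i + ∑ j, Q f j * β j) := by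
    simpa using hΓ B₃ (fun f ↦ ∑ i, P f i * x i + ∑ j, Q f j * β j)
  have hW0 : 0 ≤ W := by simpa using hW B₃
  have hρz : 0 ≤ ∑ i, ρx i * x i ^ 2 + ∑ j, ρβ j * β j ^ 2 :=
    add_nonneg (Finset.sum_nonneg fun i _ ↦ mul_nonneg (hρx i) (sq_nonneg _))
      (Finset.sum_nonneg fun j _ ↦ mul_nonneg (hρβ j) (sq_nonneg _))
  have hρs : 0 ≤ ∑ i, ρx i + ∑ j, ρβ j :=
    add_nonneg (Finset.sum_nonneg fun i _ ↦ hρx i) (Finset.sum_nonneg fun j _ ↦ hρβ j)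
  have hT0 : 0 ≤ ((1 + θ) * Γ (fun f ↦ ∑ i, P f i * x i + ∑ j, Q f j * β j)
      + (1 + 1 / θ) * (W * ((∑ i, ρx i + ∑ j, ρβ j) * (∑ i, ρx i * x i ^ 2 + ∑ j, ρβ j * β j ^ 2)))) / d₀ := by
    positivity
  rcases le_or_gt N B₃ with hN | hN
  · -- `[B, N) ⊆ [B, B₃)`
    have hsub : Ico B N ⊆ Ico B B₃ := Finset.Ico_subset_Ico_right hN
    calc ∑ m ∈ Ico B N, (∑ i : Fin B, M i m * x i + ∑ j, c m j * β j) ^ 2 / dhat m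
        ≤ ∑ m ∈ Ico B B₃, (∑ i : Fin B, M i m * x i + ∑ j, c m j * β j) ^ 2 / dhat m :=
          Finset.sum_le_sum_of_subset_of_nonneg hsub fun m hm _ ↦ by
            have := hd m (Finset.mem_Ico.1 hm).1; positivity
      _ ≤ Ufin x β := hfin x β
      _ ≤ _ := le_add_of_nonneg_right hT0
  · rw [← Finset.sum_Ico_consecutive _ hBB hN.le]
    exact add_le_add (hfin x β) htail


/-! ## The shifted coupling -/

/-- **The structured tail for the shifted coupling (`hUq` of the DoorB certificates).**  Rows `M(i,m)`, limit images `c(m,j)`,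
profile table `V(m,j)` expanded over the families on `[B₃, ∞)` (`V` exactly), free map `Λ = (Λ₁, Λ₂)`, exact middle-range
majorant `Ufin` of the SHIFTED images on `[B, B₃)`, floor `d₀`, remainder weights `w` (`Σ w² ≤ W`), and any `N`-uniform Gram
majorant `Γ` of the families give, for every `N`, `x`, `β`:
`Σ_{m∈[B,N)} (Σ_i M(i,m)x_i + Σ_j c(m,j)β_j − Σ_j V(m,j)(Σ_i Λ₁(j,i)x_i + Σ_{j'} Λ₂(j,j')β_{j'}))²/d̂_m`
`  ≤ Ufin(x,β) + ((1+θ)·Γ(u) + (1+θ⁻¹)·W·(Σρx + Σρβ)·(Σ_i ρx_i x_i² + Σ_j ρβ_j β_j²))/d₀`,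
`u_f = Σ_i (P(f,i) − Σ_j R(f,j)Λ₁(j,i))x_i + Σ_{j'} (Q(f,j') − Σ_j R(f,j)Λ₂(j,j'))β_{j'}`. -/
theorem coupling_majorant_gram_shifted (M : ℕ → ℕ → ℝ) {B B₃ r F : ℕ} (hBB : B ≤ B₃) (c V : ℕ → Fin r → ℝ)
    (Λ₁ : Fin r → Fin B → ℝ) (Λ₂ : Fin r → Fin r → ℝ)
    (dhat : ℕ → ℝ) (hd : ∀ m, B ≤ m → 0 < dhat m) {d₀ : ℝ} (hd₀ : 0 < d₀) (hd₃ : ∀ m, B₃ ≤ m → d₀ ≤ dhat m)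
    (Ufin : (Fin B → ℝ) → (Fin r → ℝ) → ℝ)
    (hfin : ∀ (x : Fin B → ℝ) (β : Fin r → ℝ),
      ∑ m ∈ Ico B B₃, (∑ i : Fin B, M i m * x i + ∑ j, c m j * β j
        - ∑ j, V m j * (∑ i, Λ₁ j i * x i + ∑ j', Λ₂ j j' * β j')) ^ 2 / dhat m ≤ Ufin x β)
    (ε : ℕ → ℝ) (hε : ∀ m, ε m ^ 2 = 1)
    (φ : Fin F → ℕ → ℝ) (P : Fin F → Fin B → ℝ) (Q R : Fin F → Fin r → ℝ)
    (w : ℕ → ℝ) (ρx : Fin B → ℝ) (ρβ : Fin r → ℝ) (hρx : ∀ i, 0 ≤ ρx i) (hρβ : ∀ j, 0 ≤ ρβ j)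
    (hM : ∀ m, B₃ ≤ m → ∀ i : Fin B, |M i m - ε m * ∑ f, P f i * φ f m| ≤ ρx i * w m)
    (hc : ∀ m, B₃ ≤ m → ∀ j : Fin r, |c m j - ε m * ∑ f, Q f j * φ f m| ≤ ρβ j * w m)
    (hV : ∀ m, B₃ ≤ m → ∀ j : Fin r, V m j = ε m * ∑ f, R f j * φ f m)
    {W : ℝ} (hW : ∀ N, ∑ m ∈ Ico B₃ N, w m ^ 2 ≤ W)
    (Γ : (Fin F → ℝ) → ℝ) (hΓ : ∀ (N : ℕ) (u : Fin F → ℝ), ∑ m ∈ Ico B₃ N, (∑ f, u f * φ f m) ^ 2 ≤ Γ u)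
    {θ : ℝ} (hθ : 0 < θ) (N : ℕ) (x : Fin B → ℝ) (β : Fin r → ℝ) :
    ∑ m ∈ Ico B N, (∑ i : Fin B, M i m * x i + ∑ j, c m j * β j
        - ∑ j, V m j * (∑ i, Λ₁ j i * x i + ∑ j', Λ₂ j j' * β j')) ^ 2 / dhat m
      ≤ Ufin x β + ((1 + θ) * Γ (fun f ↦ ∑ i, (P f i - ∑ j, R f j * Λ₁ j i) * x i
            + ∑ j', (Q f j' - ∑ j, R f j * Λ₂ j j') * β j')
          + (1 + 1 / θ) * (W * ((∑ i, ρx i + ∑ j, ρβ j) * (∑ i, ρx i * x i ^ 2 + ∑ j, ρβ j * β j ^ 2)))) / d₀ := by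
  -- rewrite every shifted image in coordinates
  have hshift : ∀ (x : Fin B → ℝ) (β : Fin r → ℝ) (m : ℕ), (∑ i : Fin B, M i m * x i + ∑ j, c m j * β j
      - ∑ j, V m j * (∑ i, Λ₁ j i * x i + ∑ j', Λ₂ j j' * β j'))
      = ∑ i : Fin B, (M i m - ∑ j, V m j * Λ₁ j i) * x i + ∑ j', (c m j' - ∑ j, V m j * Λ₂ j j') * β j' :=
    fun x β m ↦ shifted_image_eq (fun i : Fin B ↦ M i m) (c m) (V m) Λ₁ Λ₂ x β
  have hfin' : ∀ (x : Fin B → ℝ) (β : Fin r → ℝ),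
      ∑ m ∈ Ico B B₃, (∑ i : Fin B, (M i m - ∑ j, V m j * Λ₁ j i) * x i
        + ∑ j', (c m j' - ∑ j, V m j * Λ₂ j j') * β j') ^ 2 / dhat m ≤ Ufin x β := by
    intro x β
    have h := hfin x β
    simp only [hshift] at h
    exact h
  simp only [hshift]
  exact coupling_majorant_gram_fin (fun (i : Fin B) m ↦ M i m - ∑ j, V m j * Λ₁ j i) hBB
    (fun m j' ↦ c m j' - ∑ j, V m j * Λ₂ j j')
    dhat hd hd₀ hd₃ Ufin hfin' ε hε φ (fun f i ↦ P f i - ∑ j, R f j * Λ₁ j i) (fun f j' ↦ Q f j' - ∑ j, R f j * Λ₂ j j')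
    w ρx ρβ hρx hρβ
    (fun m hm i ↦ abs_shifted_row_sub_families_le (hM m hm) (hV m hm) Λ₁ i)
    (fun m hm j' ↦ abs_shifted_image_sub_families_le (hc m hm) (hV m hm) Λ₂ j') hW Γ hΓ hθ N x β

end Summit.RiemannHypothesis.RiemannHypothesis.Theorems.WeilFormatC
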